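import Summits.QuantumFields.YangMills.Theses.CheckerboardTriality
import Summits.QuantumFields.YangMills.Theorems.CheckerboardTrialityHyperoctahedralRung
import Summits.QuantumFields.YangMills.Theorems.BalabanLadderROTSingleAngle
import Summits.QuantumFields.YangMills.Theorems.BalabanLadderROTAxisCell
import Literature.Analysis.FluidPDE.OctahedralSymmetry
import HarnessLib

/-!
# Route `CheckerboardTriality`: the support item `Sigma3DenseUpgrade` (stmt-QuantumFields-23399)

LINE g10-A «sigma3-twin» of planner ym-idea-1 g10 (restrict-then-tighten on the crux `SexticClosure`), TIGHTEN step: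
pure group theory plus the tree's orbit continuity (`King.continuous_orbit` inside `King.orbit_eq_of_king`).

* (i) the Σ3 coincidence rotation `g₃ = 1 ⊕ (1/3)[[1,2,2],[2,1,−2],[−2,2,−1]]` exists as a linear isometry of `ℝ⁴`:
  it is `P ∘ R_{φ₀} ∘ P⁻¹`, the rotation by the angle `φ₀ = −arccos(−1/3)` (`cos φ₀ = −1/3`,
  `sin φ₀ = −2√2/3`) about the spatial axis `e₁ + e₂` fixing the time axis, written in an explicit orthonormal frame
  `P` (`exists_frame`) carrying the `(x₀,x₁)`-plane onto the rotation plane `⟨e₁ − e₂, e₃⟩` (`frame_conj_phi0_apply`);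
* (ii) for a one-field family `S₁` with `OffDiagDensity`, invariance of `S₁ n` on King's class `KingClass n r₀` under
  the signed permutations `W(B₄)` (the only `D₄`-preserving isometries used; `signedPerm_preserves_D4`) and under `g₃`
  gives invariance under `planeRot 0 θ` for EVERY angle `θ` (`planeRot_invariant_of_signedPerm_of_sigma3`):
  - `φ₀/(2π)` is irrational (`irrational_phi0_div_two_pi`, Mathlib's Niven theorem `niven`: `−1/3 ∉ {0, ±1/2, ±1}`);
  - KING'S DENSITY STEP IN THE FRAME `P` (`conj_planeRot_invariant_of_one_angle`): the family pulled back by `P`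
    (`Sₙ ∘ (P · )`, again with bounded densities off the diagonal, `offDiagDensity_comp_linActMulti` — isometries preserve the
    `L¹` norm, `integral_norm_linActMulti`) is invariant under `R_{φ₀}` and `R_{2π}` on the class, hence under every
    `R_θ` by the tree's `King.orbit_eq_of_king` (closed stabiliser subgroup containing the dense group `φ₀ℤ + 2πℤ`);
    transported back, `S₁` is invariant under the whole circle `P ∘ R_θ ∘ P⁻¹`, `θ ∈ ℝ`;
  - the frame is a word in that circle and `W(B₄)`: `P = σ₂ ∘ (P R_{−π/2} P⁻¹) ∘ σ₂ ∘ X` (`frame_eq_word`; `σ₂ : x₂ ↦ −x₂`,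
    `X : (x₀,x₁,x₂) ↦ (x₂,x₀,x₁)`), so `P` lies in the stabiliser, and `R_θ = P⁻¹ ∘ (P R_θ P⁻¹) ∘ P` does too.

No definition (the frame is an existential witness), no named fact, no sorry; standard axioms.

Width seat ym-line-sfw-p2-w4 g17 (cell ym-idea-1, free hands) for planner-of-record ym-idea-1 g10.  The crux `Sigma3Limit`
(stmt-QuantumFields-23398: the Σ3 twin invariance of the UV limit points — King's two-regularisation comparison at index 3)
remains OPEN; no summit, leg, crux or rung statement is proved here (R2d is a RECORD rung; the YM mass gap is NOT proved by
any of this).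

References: C. King, Commun. Math. Phys. 103 (1986) 323–349, Thm 2.4 and (4.10) (density mechanism); I. Niven, *Irrational
Numbers* (1956), Cor. 3.12; J. H. Conway, N. J. A. Sloane, SPLAG (1999) Ch. 4 §7.1 (`Aut(D₄) ⊇ W(B₄)`).
-/

set_option autoImplicit false

noncomputable section

open scoped SchwartzMap
open MeasureTheory Filter Topology
open Literature.MathematicalPhysics.QuantumFieldTheory Literature.MathematicalPhysics.QuantumLattice
open Literature.MathematicalPhysics.AQFT Literature.Probability.LatticeModels
open Summit.QuantumFields.YangMills.Cruxes.OSLegsFromFemtoAndGap.DlrCollarTransfer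
open Summit.QuantumFields.YangMills.Cruxes.OSLegsAtWeakCouplingC.Sketch
open Summit.QuantumFields.YangMills.Cruxes.OSLegsAtWeakCouplingC.Y2Bridge
open Summit.QuantumFields.YangMills.Theorems.NPointIsotropy.Negative (E4)
open Summit.QuantumFields.YangMills.Theorems.OSLegsFromFemtoAndGap.Upgrade (linActMulti_trans_eq)
open Summit.QuantumFields.YangMills.Theorems.ROT (linActMulti_planeRot_two_pi linActMulti_linActMulti_symm)
open Summit.QuantumFields.YangMills.Theorems.OSLegsAtWeakCouplingC
  (linActMulti_hasCompactSupport tsupport_linActMulti_subset_separated)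
open Literature.Analysis.FluidPDE (signedPermIsometry signedPermIsometry_apply isSignedPermIsometry_signedPermIsometry)

namespace Summit.QuantumFields.YangMills.Theorems.Sigma3

/-- `(√2)² = 2`. -/
private theorem sqrt_two_sq : Real.sqrt 2 ^ 2 = 2 := Real.sq_sqrt (by norm_num)

/-! ## The frame `P` adapted to the Σ3 axis (an existential witness, no definition) -/

/-- **The frame isometry `P`**: `P e₀ = (0,½,−½,−1/√2)`, `P e₁ = (0,−½,½,−1/√2)`, `P e₂ = e₀`, `P e₃ = (e₁+e₂)/√2` —
an orthonormal frame carrying the `(x₀,x₁)`-plane onto the rotation plane `⟨e₁ − e₂, e₃⟩` of the Σ3 coincidence rotation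
and the `(x₂,x₃)`-plane onto its fixed plane `⟨e₀, e₁ + e₂⟩`; recorded by the coordinates of `P` and of `P⁻¹ = Pᵀ`.
[folklore] -/
theorem exists_frame : ∃ P : E4 ≃ₗᵢ[ℝ] E4,
    (∀ x : E4, P x 0 = x 2 ∧ P x 1 = x 3 * Real.sqrt 2 / 2 + (x 0 - x 1) / 2 ∧
      P x 2 = x 3 * Real.sqrt 2 / 2 - (x 0 - x 1) / 2 ∧ P x 3 = -((x 0 + x 1) * Real.sqrt 2 / 2)) ∧
    (∀ y : E4, P.symm y 0 = (y 1 - y 2) / 2 - y 3 * Real.sqrt 2 / 2 ∧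
      P.symm y 1 = (y 2 - y 1) / 2 - y 3 * Real.sqrt 2 / 2 ∧ P.symm y 2 = y 0 ∧
      P.symm y 3 = (y 1 + y 2) * Real.sqrt 2 / 2) := by
  have h := sqrt_two_sq
  refine ⟨LinearIsometryEquiv.mk
    { toFun := fun x => WithLp.toLp 2 fun j : Fin 4 =>
        if j = 0 then x 2 else if j = 1 then x 3 * Real.sqrt 2 / 2 + (x 0 - x 1) / 2
        else if j = 2 then x 3 * Real.sqrt 2 / 2 - (x 0 - x 1) / 2 else -((x 0 + x 1) * Real.sqrt 2 / 2)
      invFun := fun y => WithLp.toLp 2 fun j : Fin 4 =>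
        if j = 0 then (y 1 - y 2) / 2 - y 3 * Real.sqrt 2 / 2 else if j = 1 then (y 2 - y 1) / 2 - y 3 * Real.sqrt 2 / 2
        else if j = 2 then y 0 else (y 1 + y 2) * Real.sqrt 2 / 2
      map_add' := fun x y => by
        ext j
        simp only [PiLp.add_apply]
        split_ifs <;> ring
      map_smul' := fun c x => by
        ext j
        simp only [PiLp.smul_apply, smul_eq_mul, RingHom.id_apply]
        split_ifs <;> ring
      left_inv := fun x => by
        ext j
        fin_cases j <;> simp
        · linear_combination (x 0 + x 1) / 4 * h
        · linear_combination (x 0 + x 1) / 4 * h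
        · linear_combination x 3 / 2 * h
      right_inv := fun y => by
        ext j
        fin_cases j <;> simp
        · linear_combination (y 1 + y 2) / 4 * h
        · linear_combination (y 1 + y 2) / 4 * h
        · linear_combination y 3 / 2 * h } fun x => ?_, fun x => ?_, fun y => ?_⟩
  · -- isometry
    rw [EuclideanSpace.norm_eq, EuclideanSpace.norm_eq]
    congr 1
    simp only [Fin.sum_univ_four, Real.norm_eq_abs, sq_abs]
    simp
    linear_combination (x 3 ^ 2 / 2 + (x 0 + x 1) ^ 2 / 4) * h
  · exact ⟨rfl, rfl, rfl, rfl⟩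
  · exact ⟨rfl, rfl, rfl, rfl⟩

/-- The Σ3 angle `φ₀ = −arccos(−1/3)`: `cos φ₀ = −1/3`. [folklore] -/
theorem cos_phi0 : Real.cos (-Real.arccos (-1 / 3)) = -1 / 3 := by
  rw [Real.cos_neg, Real.cos_arccos (by norm_num) (by norm_num)]

/-- `sin φ₀ = −2√2/3`. [folklore] -/
theorem sin_phi0 : Real.sin (-Real.arccos (-1 / 3)) = -(Real.sqrt 2 * (2 / 3)) := by
  rw [Real.sin_neg, Real.sin_arccos]
  congr 1
  rw [show (1 : ℝ) - (-1 / 3) ^ 2 = 2 * (2 / 3) ^ 2 by norm_num, Real.sqrt_mul (by norm_num : (0:ℝ) ≤ 2),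
    Real.sqrt_sq (by norm_num)]

/-- **The Σ3 angle is an irrational multiple of `2π`** (Mathlib's Niven theorem: `cos φ₀ = −1/3 ∉ {0, ±1/2, ±1}`).
[I. Niven, *Irrational Numbers* (1956), Cor. 3.12] -/
theorem irrational_phi0_div_two_pi : Irrational (-Real.arccos (-1 / 3) / (2 * Real.pi)) := by
  rintro ⟨q, hq⟩
  have hθ : ∃ r : ℚ, -Real.arccos (-1 / 3) = r * Real.pi := by
    refine ⟨2 * q, ?_⟩
    have hπ : (Real.pi : ℝ) ≠ 0 := Real.pi_ne_zero
    push_cast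
    rw [hq]
    field_simp
  have hcos : ∃ q' : ℚ, Real.cos (-Real.arccos (-1 / 3)) = q' := ⟨-1 / 3, by rw [cos_phi0]; push_cast; ring⟩
  have h := niven hθ hcos
  rw [cos_phi0] at h
  simp only [Set.mem_insert_iff, Set.mem_singleton_iff] at h
  norm_num at h

section Frame

variable (P : E4 ≃ₗᵢ[ℝ] E4)
  (hP : ∀ x : E4, P x 0 = x 2 ∧ P x 1 = x 3 * Real.sqrt 2 / 2 + (x 0 - x 1) / 2 ∧
    P x 2 = x 3 * Real.sqrt 2 / 2 - (x 0 - x 1) / 2 ∧ P x 3 = -((x 0 + x 1) * Real.sqrt 2 / 2))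
  (hPs : ∀ y : E4, P.symm y 0 = (y 1 - y 2) / 2 - y 3 * Real.sqrt 2 / 2 ∧
    P.symm y 1 = (y 2 - y 1) / 2 - y 3 * Real.sqrt 2 / 2 ∧ P.symm y 2 = y 0 ∧
    P.symm y 3 = (y 1 + y 2) * Real.sqrt 2 / 2)
include hP hPs

/-- **`P ∘ R_{φ₀} ∘ P⁻¹` is the Σ3 coincidence rotation** `1 ⊕ (1/3)[[1,2,2],[2,1,−2],[−2,2,−1]]` (it fixes `x₀` and the
spatial axis `e₁ + e₂`, rotation angle `φ₀`, `cos φ₀ = −1/3`). [folklore] -/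
theorem frame_conj_phi0_apply (x : E4) :
    (P.symm.trans ((planeRot (0 : Fin 3) (-Real.arccos (-1 / 3))).trans P)) x 0 = x 0 ∧
    (P.symm.trans ((planeRot (0 : Fin 3) (-Real.arccos (-1 / 3))).trans P)) x 1 = (x 1 + 2 * x 2 + 2 * x 3) / 3 ∧
    (P.symm.trans ((planeRot (0 : Fin 3) (-Real.arccos (-1 / 3))).trans P)) x 2 = (2 * x 1 + x 2 - 2 * x 3) / 3 ∧
    (P.symm.trans ((planeRot (0 : Fin 3) (-Real.arccos (-1 / 3))).trans P)) x 3 = (-2 * x 1 + 2 * x 2 - x 3) / 3 := by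
  have h := sqrt_two_sq
  simp only [LinearIsometryEquiv.coe_trans, Function.comp_apply, hP, planeRot_apply, Fin.succ_zero_eq_one, hPs,
    cos_phi0, sin_phi0]
  simp
  refine ⟨?_, ?_, ?_⟩
  · linear_combination (x 1 / 4 + x 2 / 4 + x 3 / 3) * h
  · linear_combination (x 1 / 4 + x 2 / 4 - x 3 / 3) * h
  · linear_combination (-(x 1 / 3) + x 2 / 3 - x 3 / 6) * h

/-- **The frame is a word in the circle and `W(B₄)`**: `P = σ₂ ∘ (P R_{−π/2} P⁻¹) ∘ σ₂ ∘ X` with the sign change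
`σ₂ : x₂ ↦ −x₂` and the coordinate cycle `X : (x₀,x₁,x₂,x₃) ↦ (x₂,x₀,x₁,x₃)`. [folklore] -/
theorem frame_eq_word :
    P = (signedPermIsometry ((Equiv.swap (0 : Fin 4) 2).trans (Equiv.swap (0 : Fin 4) 1)) fun _ => 1).trans
      ((signedPermIsometry (Equiv.refl (Fin 4)) fun j => if j = 2 then -1 else 1).trans
        ((P.symm.trans ((planeRot (0 : Fin 3) (-(Real.pi / 2))).trans P)).trans
          (signedPermIsometry (Equiv.refl (Fin 4)) fun j => if j = 2 then -1 else 1))) := by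
  have h := sqrt_two_sq
  refine LinearIsometryEquiv.ext fun x => ?_
  ext j
  simp only [LinearIsometryEquiv.coe_trans, Function.comp_apply]
  fin_cases j <;>
    simp [signedPermIsometry_apply, hP, hPs, Equiv.swap_apply_def, Real.cos_neg, Real.sin_neg]
  · linear_combination (-(x 0 / 4) + x 1 / 4) * h
  · linear_combination (x 0 / 4 - x 1 / 4) * h
  · ring

end Frame

/-! ## Transport of the density bound and of King's density step by a fixed isometry -/

/-- The diagonal action of a linear isometry preserves the `L¹` norm on `(ℝ⁴)ⁿ`. [folklore] -/
theorem integral_norm_linActMulti {n : ℕ} (R : E4 ≃ₗᵢ[ℝ] E4) (F : 𝓢((Fin n → E4), ℂ)) :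
    ∫ x, ‖linActMulti R F x‖ = ∫ x, ‖F x‖ := by
  let e : (Fin n → E4) ≃ᵐ (Fin n → E4) :=
    MeasurableEquiv.piCongrRight fun _ => R.symm.toHomeomorph.toMeasurableEquiv
  have he : MeasurePreserving e volume volume :=
    volume_preserving_pi fun _ => R.symm.measurePreserving
  exact he.integral_comp' (fun x => ‖F x‖)

/-- Bounded densities off the diagonal are inherited by the family pulled back by a fixed isometry,
`(S₁ ∘ P)ₙ = S₁ₙ ∘ (P · )`. [folklore] -/
theorem offDiagDensity_comp_linActMulti (S₁ : SchwingerFamily E4) (hd : OffDiagDensity S₁) (P : E4 ≃ₗᵢ[ℝ] E4) :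
    OffDiagDensity (fun m => (S₁ m).comp (linActMulti P)) := by
  intro n δ hδ
  obtain ⟨B, hB⟩ := hd n δ hδ
  refine ⟨B, fun F hFc hFδ => ?_⟩
  rw [ContinuousLinearMap.comp_apply, ← integral_norm_linActMulti P F]
  exact hB _ (linActMulti_hasCompactSupport P hFc) (tsupport_linActMulti_subset_separated P hFδ)

/-- `(P R P⁻¹) · F = P · (R · (P⁻¹ · F))`. [folklore] -/
theorem linActMulti_conj {n : ℕ} (P R : E4 ≃ₗᵢ[ℝ] E4) (F : 𝓢((Fin n → E4), ℂ)) :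
    linActMulti (P.symm.trans (R.trans P)) F = linActMulti P (linActMulti R (linActMulti P.symm F)) := by
  rw [linActMulti_trans_eq, linActMulti_trans_eq]

/-- **King's density step transported by a fixed isometry `P`**: if a density-bounded one-field family is invariant on
King's class under `P ∘ R_{θ₀} ∘ P⁻¹` for ONE angle `θ₀` with `θ₀/(2π)` irrational, it is invariant under `P ∘ R_θ ∘ P⁻¹`
for every `θ` — the pulled-back family `S₁ ∘ (P · )` has bounded densities, is invariant under `R_{θ₀}` and (trivially)
`R_{2π}`, and the tree's `King.orbit_eq_of_king` applies to it with the dense angle group `θ₀ℤ + 2πℤ`. [C. King, CMP 103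
(1986) Thm 2.4 — mechanism] -/
theorem conj_planeRot_invariant_of_one_angle (S₁ : SchwingerFamily E4) (hdens : OffDiagDensity S₁) {n : ℕ}
    {r₀ : ℝ} (P : E4 ≃ₗᵢ[ℝ] E4) {θ₀ : ℝ} (hθ₀ : Irrational (θ₀ / (2 * Real.pi)))
    (h₀ : ∀ F ∈ King.KingClass n r₀,
      S₁ n (linActMulti (P.symm.trans ((planeRot (0 : Fin 3) θ₀).trans P)) F) = S₁ n F)
    (F : 𝓢((Fin n → E4), ℂ)) (hF : F ∈ King.KingClass n r₀) (θ : ℝ) :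
    S₁ n (linActMulti (P.symm.trans ((planeRot (0 : Fin 3) θ).trans P)) F) = S₁ n F := by
  have hking : ∀ F ∈ King.KingClass n r₀, ∀ θ ∈ ({θ₀, 2 * Real.pi} : Set ℝ),
      (fun m => (S₁ m).comp (linActMulti P)) n (linActMulti (planeRot (0 : Fin 3) θ) F) =
        (fun m => (S₁ m).comp (linActMulti P)) n F := by
    intro F hF θ hθ
    simp only [ContinuousLinearMap.comp_apply]
    rcases Set.mem_insert_iff.1 hθ with rfl | hθ
    · have h := h₀ _ (King.linActMulti_mem_kingClass hF P)
      have e : linActMulti P.symm (linActMulti P F) = F := by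
        simpa using linActMulti_linActMulti_symm P.symm F
      rwa [linActMulti_conj, e] at h
    · rw [Set.mem_singleton_iff.1 hθ, linActMulti_planeRot_two_pi]
  have hdense : Dense ((AddSubgroup.closure ({θ₀, 2 * Real.pi} : Set ℝ) : AddSubgroup ℝ) : Set ℝ) :=
    dense_addSubgroupClosure_pair_iff.2 hθ₀
  have key := King.orbit_eq_of_king (fun m => (S₁ m).comp (linActMulti P))
    (offDiagDensity_comp_linActMulti S₁ hdens P) hdense hking
    (linActMulti P.symm F) (King.linActMulti_mem_kingClass hF P.symm) θ
  simp only [ContinuousLinearMap.comp_apply, linActMulti_linActMulti_symm] at key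
  rw [linActMulti_conj]
  exact key

/-! ## The density upgrade -/

/-- **All rotations of the `(x₀,x₁)`-plane from `W(B₄)` and the Σ3 rotation**: for a density-bounded one-field family,
invariance of `S₁ n` on King's class under every signed permutation and under every isometry with the Σ3 coordinates
gives invariance under `planeRot 0 θ` for every `θ` — the stabiliser of the class is closed under composition and
inverses, contains the whole circle `P R_θ P⁻¹` (transported density step from the single angle `φ₀`), the frame `P`
(a word in that circle and `W(B₄)`), hence `R_θ = P⁻¹ ∘ (P R_θ P⁻¹) ∘ P`. [C. King, CMP 103 (1986) Thm 2.4 — mechanism] -/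
theorem planeRot_invariant_of_signedPerm_of_sigma3 (S₁ : SchwingerFamily E4) (hdens : OffDiagDensity S₁) {n : ℕ}
    {r₀ : ℝ} (hW : ∀ F ∈ King.KingClass n r₀, ∀ R : E4 ≃ₗᵢ[ℝ] E4, IsSignedPerm R → S₁ n (linActMulti R F) = S₁ n F)
    (hS : ∀ F ∈ King.KingClass n r₀, ∀ R : E4 ≃ₗᵢ[ℝ] E4, (∀ x : E4, R x 0 = x 0 ∧
      R x 1 = (x 1 + 2 * x 2 + 2 * x 3) / 3 ∧ R x 2 = (2 * x 1 + x 2 - 2 * x 3) / 3 ∧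
      R x 3 = (-2 * x 1 + 2 * x 2 - x 3) / 3) → S₁ n (linActMulti R F) = S₁ n F)
    (F : 𝓢((Fin n → E4), ℂ)) (hF : F ∈ King.KingClass n r₀) (θ : ℝ) :
    S₁ n (linActMulti (planeRot (0 : Fin 3) θ) F) = S₁ n F := by
  obtain ⟨P, hP, hPs⟩ := exists_frame
  -- the stabiliser of the class and its group structure
  let H : Set (E4 ≃ₗᵢ[ℝ] E4) := {R | ∀ F ∈ King.KingClass n r₀, S₁ n (linActMulti R F) = S₁ n F}
  have htrans : ∀ {A B : E4 ≃ₗᵢ[ℝ] E4}, A ∈ H → B ∈ H → A.trans B ∈ H := fun {A B} hA hB F hF => by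
    show S₁ n (linActMulti (A.trans B) F) = S₁ n F
    rw [linActMulti_trans_eq, hB _ (King.linActMulti_mem_kingClass hF A), hA F hF]
  have hsymm : ∀ {A : E4 ≃ₗᵢ[ℝ] E4}, A ∈ H → A.symm ∈ H := fun {A} hA F hF => by
    show S₁ n (linActMulti A.symm F) = S₁ n F
    have h := hA _ (King.linActMulti_mem_kingClass hF A.symm)
    rw [linActMulti_linActMulti_symm] at h
    exact h.symm
  have hWH : ∀ R : E4 ≃ₗᵢ[ℝ] E4, IsSignedPerm R → R ∈ H := fun R hR F hF => hW F hF R hR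
  -- every rotation about the Σ3 axis (King's density step in the frame `P`, from the single angle `φ₀`)
  have hg : ∀ θ, P.symm.trans ((planeRot (0 : Fin 3) θ).trans P) ∈ H := fun θ F hF =>
    conj_planeRot_invariant_of_one_angle S₁ hdens P irrational_phi0_div_two_pi
      (fun F' hF' => hS F' hF' _ (frame_conj_phi0_apply P hP hPs)) F hF θ
  -- the frame itself, as a word in the circle and `W(B₄)`
  have hP' : P ∈ H := by
    rw [frame_eq_word P hP hPs]
    exact htrans (hWH _ (isSignedPermIsometry_signedPermIsometry _ _))
      (htrans (hWH _ (isSignedPermIsometry_signedPermIsometry _ _))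
        (htrans (hg _) (hWH _ (isSignedPermIsometry_signedPermIsometry _ _))))
  -- `R_θ = P⁻¹ ∘ (P R_θ P⁻¹) ∘ P`
  have hR : planeRot (0 : Fin 3) θ = P.trans ((P.symm.trans ((planeRot (0 : Fin 3) θ).trans P)).trans P.symm) := by
    refine LinearIsometryEquiv.ext fun x => ?_
    simp
  have hmem : planeRot (0 : Fin 3) θ ∈ H := by
    rw [hR]
    exact htrans hP' (htrans (hg θ) (hsymm hP'))
  exact hmem F hF

end Summit.QuantumFields.YangMills.Theorems.Sigma3

namespace Summit.QuantumFields.YangMills.Theorems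

open Sigma3

/-- **Item stmt-QuantumFields-23399 `CheckerboardTriality.Sigma3DenseUpgrade` holds**: (i) the Σ3 coincidence rotation
exists as a linear isometry of `ℝ⁴` with the stated rational coordinates (`P ∘ R_{φ₀} ∘ P⁻¹` in the frame of
`exists_frame`); (ii) for every one-field family with `OffDiagDensity`, every `n ≥ 2` and `r₀ > 0`, invariance of `S₁ n`
on `KingClass n r₀` under the `D₄`-preserving isometries (only `W(B₄)` is used, `signedPerm_preserves_D4`) and under the
Σ3 rotation implies invariance under `planeRot 0 θ` for every Pythagorean `θ` (indeed every `θ`). [C. King, CMP 103 (1986)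
Thm 2.4 — mechanism] -/
theorem checkerboardTriality_sigma3DenseUpgrade_proof :
    Summit.QuantumFields.YangMills.Theses.CheckerboardTriality.Sigma3DenseUpgrade := by
  unfold Summit.QuantumFields.YangMills.Theses.CheckerboardTriality.Sigma3DenseUpgrade
  obtain ⟨P, hP, hPs⟩ := exists_frame
  refine ⟨⟨P.symm.trans ((planeRot (0 : Fin 3) (-Real.arccos (-1 / 3))).trans P),
    frame_conj_phi0_apply P hP hPs⟩, ?_⟩
  intro S₁ hdens n _hn r₀ _hr₀ hD4 hS3 F hF θ _hθ
  exact planeRot_invariant_of_signedPerm_of_sigma3 S₁ hdens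
    (fun F' hF' R hR => hD4 F' hF' R (CheckerboardTrialityHyperoctahedral.signedPerm_preserves_D4 R hR))
    hS3 F hF θ

end Summit.QuantumFields.YangMills.Theorems

end
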